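import Literature.NumberTheory.EllipticCurves.DeShalit1987.LMeasureCosetValuesProofs
import Literature.NumberTheory.ComplexMultiplication.EllipticUnits.RayClassFieldRelGalArtin
import HarnessLib

set_option autoImplicit false

/-!
# de Shalit II.5.2 (4): the Gauss factor of the coset-value identity depends on `χ` only through its INERTIA TYPE
# `χ ∘ δ` (II.4.11 Remark (i), II.4.8 (19)), and an inertia type of exact level `n` supplies the exact-level binder
# of `exists_cosetValueIdentity`

Topic `NumberTheory/EllipticCurves`, grouping sub-namespace `DeShalit1987` (the home of the receptacle
`LMeasureCosetValues{,Proofs}.lean`: `gaussSumInv`, `cval`, `pEmb`, `IsCosetValues`, `exists_cosetValueIdentity`).  Built on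
`ComplexMultiplication/EllipticUnits/RayClassFieldRelGalArtin.lean` (the membership lemma `artinSymbol_span_singleton_mem_relGalSet` and de Shalit's II.1.7
homomorphism `kappaArtinHom`).  Everything is PROVED except that `HasExactInertiaLevel` is a DEFINITION (a predicate on
`χ` with explicit binders, nothing asserted); no named fact, no instance, no `sorry`.

de Shalit II.4.8 (19) (p. 61): `τ(χ) = p⁻ⁿ Σ_{γ ∈ Gal(F_n/F)} χ(γ) ζ_n^{−κ(γ)}`; II.4.11 Remark (i) (p. 65): "`G(ε)` … depends only
on `ε` as a whole"; II.5.2 (p. 80): "Note that `G(χ⁻¹) = χ⁻¹(𝔮)τ(χ⁻¹)`"; II.5.2 (4) (p. 79): the coset-value identity.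

* §1 `cval_mul`, `cval_one`, `cval_inv_mul_self`; ★ `gaussSumInv_mul_cval` (`G(χ⁻¹)·ι⁻¹χ(γ₀|) = p⁻ⁿ Σ_a ι⁻¹χ(δ_a)⁻¹ j_p(γ₀ζ)^{−a}`),
  `gaussSumInv_mul_cval_eq_of_inertiaType`, ★ `gaussSumInv_mul_cval_congr` (two characters agreeing on `Gal(K(𝔤)/K(𝔣))` have
  the same normalised Gauss factor), `gaussSumInv_mul_cval_congr_kappaRep`.
* §2 `HasExactInertiaLevel v 𝔣 n α χ` (`∃ a ≡ 1 (p^{n−1}), χ(δ_a) ≠ 1`), ★ `exists_mem_relGalSet_ne_one_of_hasExactInertiaLevel`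
  (⟹ the binder `∃ δ ∈ relGalSet K (𝔣vⁿ) (𝔣v^{n−1}), χ δ ≠ 1` of `IsCosetValues` / `exists_cosetValueIdentity`),
  `exists_mem_relGalSet_ne_one_of_inertiaType`, `hasExactInertiaLevel_congr` (representative-independence).
* §3 ★★ `exists_cosetValueIdentity_of_hasExactInertiaLevel` — the tree's `exists_cosetValueIdentity` with its abstract exact-level
  binder replaced by `HasExactInertiaLevel` (every other binder verbatim), re-emitting the level property for the output
  representatives.

## References

* [deShalit1987] E. de Shalit, *Iwasawa theory of elliptic curves with complex multiplication* (1987), II.1.7 (p. 37), II.4.8 (19)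
  (p. 61), II.4.11 (30) and Remark (i) (p. 65–66), II.4.16 (p. 76), II.5.2 (4) (p. 79–80).
* J. Silverman, *Advanced Topics in the Arithmetic of Elliptic Curves* (1994), II §9 Thm. 9.2 (background only: the
  reciprocity map sends local units onto inertia).
-/

noncomputable section

open scoped Classical
open NumberField IsDedekindDomain Field
open Literature.NumberTheory.GaloisRepresentations
open Literature.NumberTheory.ComplexMultiplication.EllipticUnits
open Literature.NumberTheory.NumberFields
open Literature.NumberTheory.LFunctions
open Literature.NumberTheory.LFunctions.AbelianDensity (artinSymbol ArtinKillsRay artinSymbol_mul)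
open Literature.NumberTheory.EllipticCurves

namespace Literature.NumberTheory.EllipticCurves

namespace DeShalit1987

variable {K : Type} [Field K] [NumberField K]

/-! ## §1 Gauss-factor rigidity: `G(χ⁻¹)·χ(γ₀|) = τ(χ ∘ δ)` depends on the inertia type only -/

section Gauss

variable {p : ℕ} [Fact p.Prime]

omit [NumberField K] in
/-- `ι⁻¹` is multiplicative on character values. [cite: deShalit1987, II.4.16 (p. 76)] -/
theorem cval_mul (ι : PadicAlgCl p ≃+* ℂ) (z w : ℂˣ) : cval ι (z * w) = cval ι z * cval ι w := by
  simp only [cval, Units.val_mul, map_mul, PadicComplex.coe_eq]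

omit [NumberField K] in
/-- `ι⁻¹ 1 = 1`. [cite: deShalit1987, II.4.16 (p. 76)] -/
theorem cval_one (ι : PadicAlgCl p ≃+* ℂ) : cval ι 1 = 1 := by
  simp only [cval, Units.val_one, map_one, PadicComplex.coe_eq]

omit [NumberField K] in
/-- `ι⁻¹(z⁻¹) · ι⁻¹(z) = 1`. [cite: deShalit1987, II.4.16 (p. 76)] -/
theorem cval_inv_mul_self (ι : PadicAlgCl p ≃+* ℂ) (z : ℂˣ) : cval ι z⁻¹ * cval ι z = 1 := by
  rw [← cval_mul, inv_mul_cancel, cval_one]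

/-- **`τ`-form of the tree's Gauss factor** (print p. 80: "`G(χ⁻¹) = χ⁻¹(𝔮)τ(χ⁻¹)`", with `γ₀` in the
rôle of `σ_𝔮` and (19) `τ(χ) = p⁻ⁿ Σ_{γ ∈ Gal(F_n/F)} χ(γ) ζ_n^{−κ(γ)}`):
`gaussSumInv · ι⁻¹χ(γ₀|_{K(𝔤)}) = p⁻ⁿ Σ_a ι⁻¹χ(δ_a)⁻¹ · j_p(γ₀ζ)^{−a}`.
[cite: deShalit1987, II.4.8 (19) (p. 61), II.5.2 (p. 80)] -/
theorem gaussSumInv_mul_cval (ι : PadicAlgCl p ≃+* ℂ) (ιK : K →+* ℂ) (𝔤 : Ideal (𝓞 K)) (n : ℕ)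
    (χ : RayGal K 𝔤 →* ℂˣ) (γ₀ : absoluteGaloisGroup K) (ζ : AlgebraicClosure K)
    (α : (ZMod (p ^ n))ˣ → 𝓞 K) :
    gaussSumInv ι ιK 𝔤 n χ γ₀ ζ α * cval ι (χ (absRestrictNormalHom (rayClassField K 𝔤) γ₀)) =
      ((p : ℂ_[p]) ^ n)⁻¹ * ∑ a : (ZMod (p ^ n))ˣ,
        cval ι (χ (artinSymbol (galFrob K (rayClassField K 𝔤)) (Ideal.span {α a})))⁻¹ *
          ((pEmb ι ιK (γ₀ • ζ)) ^ (a : ZMod (p ^ n)).val)⁻¹ := by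
  unfold gaussSumInv
  set S := ∑ a : (ZMod (p ^ n))ˣ,
        cval ι (χ (artinSymbol (galFrob K (rayClassField K 𝔤)) (Ideal.span {α a})))⁻¹ *
          ((pEmb ι ιK (γ₀ • ζ)) ^ (a : ZMod (p ^ n)).val)⁻¹
  set c := χ (absRestrictNormalHom (rayClassField K 𝔤) γ₀)
  calc ((p : ℂ_[p]) ^ n)⁻¹ * cval ι c⁻¹ * S * cval ι c
      = ((p : ℂ_[p]) ^ n)⁻¹ * S * (cval ι c⁻¹ * cval ι c) := by ring
    _ = ((p : ℂ_[p]) ^ n)⁻¹ * S := by rw [cval_inv_mul_self, mul_one]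

/-- **Inertia-type form**: if `χ(δ_a) = θ(a)` for a character `θ` of `(ℤ/pⁿ)ˣ` (the INERTIA TYPE of `χ`,
e.g. `θ = χ ∘ kappaArtinHom`), then `gaussSumInv · ι⁻¹χ(γ₀|) = p⁻ⁿ Σ_a ι⁻¹θ(a)⁻¹ j_p(γ₀ζ)^{−a}` —
the classical Gauss sum of `θ⁻¹` against the `pⁿ`-th root of unity `j_p(γ₀ζ)`: the `𝔣`-part of `χ`
enters `G(χ⁻¹)` only through the single value `χ(γ₀|)`. [cite: deShalit1987, II.4.8 (19) (p. 61), II.4.11 Remark (i) (p. 65)] -/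
theorem gaussSumInv_mul_cval_eq_of_inertiaType (ι : PadicAlgCl p ≃+* ℂ) (ιK : K →+* ℂ)
    (𝔤 : Ideal (𝓞 K)) (n : ℕ) (χ : RayGal K 𝔤 →* ℂˣ) (γ₀ : absoluteGaloisGroup K)
    (ζ : AlgebraicClosure K) (α : (ZMod (p ^ n))ˣ → 𝓞 K) (θ : (ZMod (p ^ n))ˣ →* ℂˣ)
    (hθ : ∀ a, χ (artinSymbol (galFrob K (rayClassField K 𝔤)) (Ideal.span {α a})) = θ a) :
    gaussSumInv ι ιK 𝔤 n χ γ₀ ζ α * cval ι (χ (absRestrictNormalHom (rayClassField K 𝔤) γ₀)) =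
      ((p : ℂ_[p]) ^ n)⁻¹ * ∑ a : (ZMod (p ^ n))ˣ,
        cval ι (θ a)⁻¹ * ((pEmb ι ιK (γ₀ • ζ)) ^ (a : ZMod (p ^ n)).val)⁻¹ := by
  rw [gaussSumInv_mul_cval]
  simp_rw [hθ]

/-- **RIGIDITY (the Gauss factor depends only on `χ|_{Gal(K(𝔤)/K(𝔣))}`)**: for `0 ≠ 𝔤 ≤ 𝔣`,
representatives `α_a ≠ 0`, `α_a ≡ 1 (𝔣)`, and two characters `χ, χ′` of `Gal(K(𝔤)/K)` that AGREE ON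
`relGalSet K 𝔤 𝔣`: `G(χ⁻¹)·χ(γ₀|) = G(χ′⁻¹)·χ′(γ₀|)` (print II.4.11 Remark (i), p. 65: "`G(ε)` … depends
only on `ε` as a whole"; (19) is a sum over `Gal(F_n/F)`). So the normalised
Gauss factor is a function of the local type `θ` at `v` alone. [cite: deShalit1987, II.4.11 Remark (i) (p. 65), II.4.8 (19) (p. 61)] -/
theorem gaussSumInv_mul_cval_congr [IsTotallyComplex K] {𝔣 𝔤 : Ideal (𝓞 K)} (h𝔤 : 𝔤 ≠ ⊥)
    (hle : 𝔤 ≤ 𝔣) (ι : PadicAlgCl p ≃+* ℂ) (ιK : K →+* ℂ) (n : ℕ) {χ χ' : RayGal K 𝔤 →* ℂˣ}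
    (hχ : ∀ σ ∈ relGalSet K 𝔤 𝔣, χ σ = χ' σ) (γ₀ : absoluteGaloisGroup K) (ζ : AlgebraicClosure K)
    {α : (ZMod (p ^ n))ˣ → 𝓞 K} (hα : ∀ a, α a ≠ 0 ∧ α a - 1 ∈ 𝔣) :
    gaussSumInv ι ιK 𝔤 n χ γ₀ ζ α * cval ι (χ (absRestrictNormalHom (rayClassField K 𝔤) γ₀)) =
      gaussSumInv ι ιK 𝔤 n χ' γ₀ ζ α * cval ι (χ' (absRestrictNormalHom (rayClassField K 𝔤) γ₀)) := by
  rw [gaussSumInv_mul_cval, gaussSumInv_mul_cval]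
  congr 1
  refine Finset.sum_congr rfl fun a _ ↦ ?_
  rw [hχ _ (artinSymbol_span_singleton_mem_relGalSet h𝔤 hle (hα a).1 (hα a).2)]

/-- The same rigidity for the honest `κ`-representatives of `IsCosetValues` (`𝔤 = 𝔣vⁿ`, `n ≥ 1`).
[cite: deShalit1987, II.4.11 Remark (i) (p. 65), II.4.11 (30) (p. 65–66)] -/
theorem gaussSumInv_mul_cval_congr_kappaRep [IsTotallyComplex K] {v : HeightOneSpectrum (𝓞 K)}
    (hv : ((p : ℕ) : 𝓞 K) ∈ v.asIdeal) {𝔣 : Ideal (𝓞 K)} (h𝔣 : 𝔣 ≠ ⊥) {n : ℕ} (hn : 1 ≤ n)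
    (ι : PadicAlgCl p ≃+* ℂ) (ιK : K →+* ℂ) {χ χ' : RayGal K (𝔣 * v.asIdeal ^ n) →* ℂˣ}
    (hχ : ∀ σ ∈ relGalSet K (𝔣 * v.asIdeal ^ n) 𝔣, χ σ = χ' σ) (γ₀ : absoluteGaloisGroup K)
    (ζ : AlgebraicClosure K) {α : (ZMod (p ^ n))ˣ → 𝓞 K}
    (hα : ∀ a, α a - 1 ∈ 𝔣 ∧ α a - ((a : ZMod (p ^ n)).val : 𝓞 K) ∈ v.asIdeal ^ n) :
    gaussSumInv ι ιK (𝔣 * v.asIdeal ^ n) n χ γ₀ ζ α *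
        cval ι (χ (absRestrictNormalHom (rayClassField K (𝔣 * v.asIdeal ^ n)) γ₀)) =
      gaussSumInv ι ιK (𝔣 * v.asIdeal ^ n) n χ' γ₀ ζ α *
        cval ι (χ' (absRestrictNormalHom (rayClassField K (𝔣 * v.asIdeal ^ n)) γ₀)) :=
  gaussSumInv_mul_cval_congr (mul_ne_zero h𝔣 (pow_ne_zero n v.ne_bot)) Ideal.mul_le_right ι ιK n hχ
    γ₀ ζ fun a ↦ ⟨kappaRep_ne_zero hv hn a (hα a).2, (hα a).1⟩

end Gauss

/-! ## §2 An inertia type of exact level `n` ⇒ the binder `hχ` of `IsCosetValues` / `exists_cosetValueIdentity` -/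

section LevelFromType

variable {p : ℕ}

/-- **Exact inertia level**: «the inertia type of `χ` at `v` has EXACT level `n`» — the character
`a ↦ χ(δ_a)` of `(ℤ/pⁿ)ˣ ≅ (𝒪_v/vⁿ)ˣ` (split `v`, `𝒪_v = ℤ_p`) is nontrivial on the kernel of
reduction to `(ℤ/p^{n-1})ˣ`. For a CM curve `E` at a split `v ∣ p` this is the assertion
that the inertia character `θ = (ψ_E λ⁻¹)|_{𝒪_v^×}` has conductor exponent exactly `n` — an INPUT, not proved here (sources: de Shalit II.1.7 (p. 37), II.4.11 (30) (p. 65); Silverman, *Advanced Topics* II §9 Thm 9.2: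
"the reciprocity map sends `R_𝔓^*` to `I_𝔓^{ab}`").  A receptacle with explicit binders (a predicate on `χ`) —
nothing is asserted. [cite: deShalit1987, II.1.7 (p. 37), II.4.11 (30) (p. 65)] -/
def HasExactInertiaLevel (v : HeightOneSpectrum (𝓞 K)) (𝔣 : Ideal (𝓞 K)) (n : ℕ)
    (α : (ZMod (p ^ n))ˣ → 𝓞 K) (χ : RayGal K (𝔣 * v.asIdeal ^ n) →* ℂˣ) : Prop :=
  ∃ a : (ZMod (p ^ n))ˣ, (a : ZMod (p ^ n)).val ≡ 1 [MOD p ^ (n - 1)] ∧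
    χ (artinSymbol (galFrob K (rayClassField K (𝔣 * v.asIdeal ^ n))) (Ideal.span {α a})) ≠ 1

/-- **Exact level ⇒ `hχ`.** An inertia type of exact level `n` yields the binder
`∃ δ ∈ relGalSet K (𝔣vⁿ) (𝔣v^{n-1}), χ δ ≠ 1` of the tree's `IsCosetValues` /
`exists_cosetValueIdentity` — by the level-`(n−1)` membership lemma. [cite: deShalit1987, II.1.7 (p. 37), II.5.2 (4) (p. 79)] -/
theorem exists_mem_relGalSet_ne_one_of_hasExactInertiaLevel [IsTotallyComplex K]
    {v : HeightOneSpectrum (𝓞 K)} (hv : ((p : ℕ) : 𝓞 K) ∈ v.asIdeal) {𝔣 : Ideal (𝓞 K)}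
    (h𝔣 : 𝔣 ≠ ⊥) (h𝔣v : IsCoprime 𝔣 v.asIdeal) {n : ℕ} (hn : 1 ≤ n)
    {α : (ZMod (p ^ n))ˣ → 𝓞 K}
    (hα : ∀ a, α a - 1 ∈ 𝔣 ∧ α a - ((a : ZMod (p ^ n)).val : 𝓞 K) ∈ v.asIdeal ^ n)
    {χ : RayGal K (𝔣 * v.asIdeal ^ n) →* ℂˣ} (hχ : HasExactInertiaLevel v 𝔣 n α χ) :
    ∃ δ ∈ relGalSet K (𝔣 * v.asIdeal ^ n) (𝔣 * v.asIdeal ^ (n - 1)), χ δ ≠ 1 := by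
  obtain ⟨a, ha, hne⟩ := hχ
  exact ⟨_, artinSymbol_kappaRep_mem_relGalSet_pred hv h𝔣 h𝔣v hn a (hα a).1 (hα a).2 ha, hne⟩

/-- **The same, phrased through a given inertia character `θ`** (`χ(δ_a) = θ(a)`, e.g.
`θ = χ ∘ kappaArtinHom`): `θ` nontrivial on `ker((ℤ/pⁿ)ˣ → (ℤ/p^{n-1})ˣ)` ⇒ `hχ`. [cite: deShalit1987, II.1.7 (p. 37), II.5.2 (4) (p. 79)] -/
theorem exists_mem_relGalSet_ne_one_of_inertiaType [IsTotallyComplex K]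
    {v : HeightOneSpectrum (𝓞 K)} (hv : ((p : ℕ) : 𝓞 K) ∈ v.asIdeal) {𝔣 : Ideal (𝓞 K)}
    (h𝔣 : 𝔣 ≠ ⊥) (h𝔣v : IsCoprime 𝔣 v.asIdeal) {n : ℕ} (hn : 1 ≤ n)
    {α : (ZMod (p ^ n))ˣ → 𝓞 K}
    (hα : ∀ a, α a - 1 ∈ 𝔣 ∧ α a - ((a : ZMod (p ^ n)).val : 𝓞 K) ∈ v.asIdeal ^ n)
    (χ : RayGal K (𝔣 * v.asIdeal ^ n) →* ℂˣ) (θ : (ZMod (p ^ n))ˣ →* ℂˣ)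
    (hθ : ∀ a, χ (artinSymbol (galFrob K (rayClassField K (𝔣 * v.asIdeal ^ n))) (Ideal.span {α a})) = θ a)
    (hprim : ∃ a : (ZMod (p ^ n))ˣ, (a : ZMod (p ^ n)).val ≡ 1 [MOD p ^ (n - 1)] ∧ θ a ≠ 1) :
    ∃ δ ∈ relGalSet K (𝔣 * v.asIdeal ^ n) (𝔣 * v.asIdeal ^ (n - 1)), χ δ ≠ 1 := by
  obtain ⟨a, ha, hne⟩ := hprim
  exact exists_mem_relGalSet_ne_one_of_hasExactInertiaLevel hv h𝔣 h𝔣v hn hα ⟨a, ha, by rwa [hθ]⟩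

end LevelFromType

/-! ## §3 The instantiation: `HasExactInertiaLevel` feeds
`DeShalit1987.exists_cosetValueIdentity` (II.5.2 (4) on every `IsCosetValues` witness) -/

section Instantiation

variable {p : ℕ}

/-- `HasExactInertiaLevel` does not depend on the choice of `κ`-representatives (the Artin symbol
kills the ray mod `𝔣vⁿ`), so the exact-level condition may be stated for ANY family of representatives — in particular
for the family that `exists_cosetValueIdentity` outputs. [cite: deShalit1987, II.1.7 (p. 37), II.4.11 (30) (p. 65–66)] -/
theorem hasExactInertiaLevel_congr [IsTotallyComplex K] {v : HeightOneSpectrum (𝓞 K)}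
    (hv : ((p : ℕ) : 𝓞 K) ∈ v.asIdeal) {𝔣 : Ideal (𝓞 K)} (h𝔣 : 𝔣 ≠ ⊥)
    (h𝔣v : IsCoprime 𝔣 v.asIdeal) {n : ℕ} (hn : 1 ≤ n) {α β : (ZMod (p ^ n))ˣ → 𝓞 K}
    (hα : ∀ a, α a - 1 ∈ 𝔣 ∧ α a - ((a : ZMod (p ^ n)).val : 𝓞 K) ∈ v.asIdeal ^ n)
    (hβ : ∀ a, β a - 1 ∈ 𝔣 ∧ β a - ((a : ZMod (p ^ n)).val : 𝓞 K) ∈ v.asIdeal ^ n)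
    (χ : RayGal K (𝔣 * v.asIdeal ^ n) →* ℂˣ) :
    HasExactInertiaLevel v 𝔣 n α χ ↔ HasExactInertiaLevel v 𝔣 n β χ := by
  unfold HasExactInertiaLevel
  refine exists_congr fun a ↦ and_congr_right fun _ ↦ ?_
  rw [artinSymbol_kappaRep_congr hv h𝔣 h𝔣v hn a (hα a).1 (hα a).2 (hβ a).1 (hβ a).2]

variable [Fact p.Prime]

/-- **II.5.2 (4) from an inertia type of exact level `n`.**
Every binder below is VERBATIM a binder of `DeShalit1987.exists_cosetValueIdentity`
(the consumer form of `IsCosetValues`), except that its abstract exact-level binder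
`hχ : ∃ δ ∈ relGalSet K (𝔣vⁿ) (𝔣vⁿ⁻¹), χ δ ≠ 1` is REPLACED by `HasExactInertiaLevel`,
`HasExactInertiaLevel v 𝔣 n β χ` for an arbitrary family `β` of `κ`-representatives (which exists by the
tree's `exists_kappaReps`). Output: II.5.2 (4) (`CosetValueIdentity`) for `χ` on the witness `μ`, with
`κ`-representatives `α` for which `χ` AGAIN has exact inertia level `n` (so §1's inertia-type form of
`G(χ⁻¹)` applies to the same `α`). [cite: deShalit1987, II.5.2 (4) (p. 79), II.4.11 (30), II.1.7] -/
theorem exists_cosetValueIdentity_of_hasExactInertiaLevel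
    (h24 : Literature.NumberTheory.ComplexMultiplication.EllipticUnits.DeShalit1987.prop24_i_mem_rayClassField)
    (hK : IsImaginaryQuadratic K) {ι : PadicAlgCl p ≃+* ℂ} {v vbar : HeightOneSpectrum (𝓞 K)}
    (hv : ((p : ℕ) : 𝓞 K) ∈ v.asIdeal) (hvbar : ((p : ℕ) : 𝓞 K) ∈ vbar.asIdeal) (hne : vbar ≠ v)
    {S : Finset (HeightOneSpectrum (𝓞 K))} {𝒰 : SubgroupTower (absoluteGaloisGroup K)}
    {μ : GroupDistribution 𝒰 ℂ_[p]} (hU : ∀ n, IsOpen (𝒰.U n : Set (absoluteGaloisGroup K)))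
    (hN : ⋂ n, (𝒰.U n : Set (absoluteGaloisGroup K)) ⊆ rayKer K p S)
    (hcv : IsCosetValues ι v vbar S 𝒰 μ)
    (ιK : K →+* ℂ) (hιK : ∀ k : 𝓞 K, k ∈ v.asIdeal ↔ ‖ι.symm (ιK (k : K))‖ < 1)
    (𝔣 : Ideal (𝓞 K)) (n : ℕ) (hn : 1 ≤ n) (h𝔣 : 𝔣 ≠ ⊥) (h𝔣v : IsCoprime 𝔣 v.asIdeal)
    (hsupp : ∀ w : HeightOneSpectrum (𝓞 K), w.asIdeal ∣ 𝔣 ↔ (w ∈ S ∨ w = vbar))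
    (hw : rootsOfUnityCongruentOne 𝔣 = 1)
    (𝔞 : Ideal (𝓞 K)) (h𝔞 : 𝔞 ≠ ⊥)
    (hcop : IsCoprime 𝔞 (Ideal.span {(6 : 𝓞 K)} * (𝔣 * v.asIdeal ^ n)))
    (χ : RayGal K (𝔣 * v.asIdeal ^ n) →* ℂˣ)
    {β : (ZMod (p ^ n))ˣ → 𝓞 K}
    (hβ : ∀ a, β a - 1 ∈ 𝔣 ∧ β a - ((a : ZMod (p ^ n)).val : 𝓞 K) ∈ v.asIdeal ^ n)
    (hlev : HasExactInertiaLevel v 𝔣 n β χ) :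
    ∃ (L La : PeriodPair) (T : Finset ℂ) (u : rayClassField K (𝔣 * v.asIdeal ^ n))
      (ζ : AlgebraicClosure K) (γ₀ : absoluteGaloisGroup K) (α : (ZMod (p ^ n))ˣ → 𝓞 K),
      (∀ z : ℂ, z ∈ L.lattice ↔ ∃ a ∈ 𝔣 * v.asIdeal ^ n, z = ιK (a : K)) ∧
      La.lattice = idealInvLattice ιK 𝔞 L.lattice ∧ L.IsLatticeReps La T ∧
      algClosureEmb ιK (u : AlgebraicClosure K) = L.deShalitTheta La T 1 ∧
      algClosureEmb ιK ζ = Complex.exp (2 * Real.pi * Complex.I / (p : ℂ) ^ n) ∧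
      (∀ m : ℕ, absRestrictNormalHom (rayClassField K (𝔣 * vbar.asIdeal ^ m)) γ₀ =
        artinSymbol (galFrob K (rayClassField K (𝔣 * vbar.asIdeal ^ m))) (v.asIdeal ^ n)) ∧
      (∀ a, α a - 1 ∈ 𝔣 ∧ α a - ((a : ZMod (p ^ n)).val : 𝓞 K) ∈ v.asIdeal ^ n) ∧
      HasExactInertiaLevel v 𝔣 n α χ ∧
      CosetValueIdentity ι ιK (𝔣 * v.asIdeal ^ n) n 𝔞 χ u γ₀ ζ α μ := by
  haveI : IsTotallyComplex K := hK.2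
  obtain ⟨L, La, T, u, ζ, γ₀, α, hL, hLa, hT, hu, hζ, hγ₀, hα, hcvi⟩ :=
    exists_cosetValueIdentity h24 hK hv hvbar hne hU hN hcv ιK hιK 𝔣 n hn h𝔣 h𝔣v hsupp hw 𝔞 h𝔞
      hcop χ (exists_mem_relGalSet_ne_one_of_hasExactInertiaLevel hv h𝔣 h𝔣v hn hβ hlev)
  exact ⟨L, La, T, u, ζ, γ₀, α, hL, hLa, hT, hu, hζ, hγ₀, hα,
    (hasExactInertiaLevel_congr hv h𝔣 h𝔣v hn hβ hα χ).mp hlev, hcvi⟩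

end Instantiation

end DeShalit1987

end Literature.NumberTheory.EllipticCurves

end
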